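import Summits.Ventures.HodgeRepro2.T5SU11WendelGammaRatio

/-!
# Explicit two-sided bounds for the Jacobi transform on `0 ≤ λ ≤ 2` and for the Abel constants
(Wendel's inequalities applied to the symmetric closed form)

Wendel's inequalities (`T5SU11WendelGammaRatio`) bound the ratios `Γ(x − u)/Γ(x)` for `0 ≤ u ≤ 1`,
`x > u`: **`(x − u)^{−u} ≤ Γ(x − u)/Γ(x) ≤ x^{1−u}/(x − u)`** (`Gamma_sub_div_ge`, `Gamma_sub_div_le`).
In the symmetric closed form `m̂_k(λ) = π Γ(x − u) Γ(x − (1 − u))/Γ(x)²`, `x = k/2`, `u = λ/2`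
(`T5SU11JacobiDuplication`), both shifts lie in `[0, 1]` exactly when `0 ≤ λ ≤ 2` — the range of the
unitary principal and complementary series parameters — and the transform is pinned between two
elementary expressions, for `k > 2`:

  **`π (x − u)^{−u} (x − 1 + u)^{u − 1} ≤ m̂_k(λ) ≤ π x/((x − u)(x − 1 + u))`**

(`jacobi_ge_wendel`, `jacobi_le_wendel`), with equality on both sides at `λ = 0` (`2π/(k − 2)`). At
`λ = 1` this is a two-sided bound for the Abel constants `C_k = √π Γ((k−1)/2)/Γ(k/2)`, valid for `k > 1`:
**`2π/(k − 1) ≤ C_k² ≤ 2πk/(k − 1)²`** (`abel_const_sq_ge`, `abel_const_sq_le`), sharpened for `k > 2` by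
`C_k² = m̂_k(1) ≤ m̂_k(0) = 2π/(k − 2)` from `Ξ ≤ 1` (`abel_const_sq_le_of_two_lt`); the squeeze
re-derives `k · C_k² → 2π` (`tendsto_mul_abel_const_sq'`, cross-checking
`T5SU11JacobiWeightAsymptotic`). Nothing is claimed about (N).

Blind lane: Mathlib + the HodgeRepro2 prefix only; no sorry; axioms ⊆ {propext, Classical.choice,
Quot.sound}.
-/

namespace Summit.Ventures.HodgeRepro2.T5SU11JacobiWendelBounds

open MeasureTheory MeasureTheory.Measure Metric Set Filter Topology
open T5SU11Unimodular T5SU11Fibration T5SU11Cartan T5HaarCircle T5BergmanCoefficient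
  T5SU11FibrationHaar T5SU11SphericalFunction T5SU11SphericalSymmetry T5SU11SphericalBounds
  T5SU11JacobiIwasawa T5SU11JacobiTransform T5SU11XiTransform T5SU11JacobiDuplication
  T5SU11WendelGammaRatio
open scoped Real

/-! ### Wendel for the ratios `Γ(x − u)/Γ(x)` -/

/-- **`(x − u)^{−u} ≤ Γ(x − u)/Γ(x)`** for `x > u`, `0 ≤ u ≤ 1`. -/
theorem Gamma_sub_div_ge {x u : ℝ} (hxu : 0 < x - u) (hu0 : 0 ≤ u) (hu1 : u ≤ 1) :
    (x - u) ^ (-u) ≤ Real.Gamma (x - u) / Real.Gamma x := by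
  have hx : 0 < x := by linarith
  have h := Gamma_add_le hxu hu0 hu1
  rw [sub_add_cancel] at h
  rw [le_div_iff₀ (Real.Gamma_pos_of_pos hx)]
  calc (x - u) ^ (-u) * Real.Gamma x ≤ (x - u) ^ (-u) * ((x - u) ^ u * Real.Gamma (x - u)) := by
        gcongr
    _ = Real.Gamma (x - u) := by
        rw [← mul_assoc, ← Real.rpow_add hxu, neg_add_cancel, Real.rpow_zero, one_mul]

/-- **`Γ(x − u)/Γ(x) ≤ x^{1−u}/(x − u)`** for `x > u`, `0 ≤ u ≤ 1`. -/
theorem Gamma_sub_div_le {x u : ℝ} (hxu : 0 < x - u) (hu0 : 0 ≤ u) (hu1 : u ≤ 1) :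
    Real.Gamma (x - u) / Real.Gamma x ≤ x ^ (1 - u) / (x - u) := by
  have hx : 0 < x := by linarith
  have h := Gamma_add_ge hxu hu0 hu1
  rw [sub_add_cancel] at h
  rw [div_le_div_iff₀ (Real.Gamma_pos_of_pos hx) hxu, mul_comm]
  exact h

/-! ### The transform on `0 ≤ λ ≤ 2` -/

section measure

variable [MeasurableSpace Circle] [BorelSpace Circle]

/-- The symmetric closed form as a product of two ratios. -/
lemma jacobi_eq_ratio_mul {k lam : ℝ} (hk : 1 < k) (h1 : lam < k) (h2 : 2 < k + lam) :
    ∫ g, (1 - ‖orbit g‖ ^ 2) ^ (k / 2) * sph lam g ∂(nu haarCircle)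
      = π * (Real.Gamma (k / 2 - lam / 2) / Real.Gamma (k / 2))
          * (Real.Gamma (k / 2 - (1 - lam / 2)) / Real.Gamma (k / 2)) := by
  rw [integral_orbit_rpow_mul_sph_dup hk h1 h2, show (k - lam) / 2 = k / 2 - lam / 2 by ring,
    show (k + lam) / 2 - 1 = k / 2 - (1 - lam / 2) by ring]
  ring

/-- **The lower Wendel bound**: for `k > 2`, `0 ≤ λ ≤ 2`,
`π (k/2 − λ/2)^{−λ/2} (k/2 − (1 − λ/2))^{−(1 − λ/2)} ≤ m̂_k(λ)`. -/
theorem jacobi_ge_wendel {k lam : ℝ} (hk : 2 < k) (h0 : 0 ≤ lam) (h2 : lam ≤ 2) :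
    π * (k / 2 - lam / 2) ^ (-(lam / 2)) * (k / 2 - (1 - lam / 2)) ^ (-(1 - lam / 2))
      ≤ ∫ g, (1 - ‖orbit g‖ ^ 2) ^ (k / 2) * sph lam g ∂(nu haarCircle) := by
  have hxu : 0 < k / 2 - lam / 2 := by linarith
  have hxv : 0 < k / 2 - (1 - lam / 2) := by linarith
  rw [jacobi_eq_ratio_mul (by linarith) (by linarith) (by linarith)]
  have hA := Gamma_sub_div_ge hxu (by linarith) (by linarith)
  have hB := Gamma_sub_div_ge hxv (by linarith) (by linarith)
  have hπ : (0 : ℝ) ≤ π := Real.pi_pos.le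
  have ha : 0 ≤ (k / 2 - lam / 2) ^ (-(lam / 2)) := Real.rpow_nonneg hxu.le _
  have hb : 0 ≤ (k / 2 - (1 - lam / 2)) ^ (-(1 - lam / 2)) := Real.rpow_nonneg hxv.le _
  have hA' : 0 ≤ Real.Gamma (k / 2 - lam / 2) / Real.Gamma (k / 2) := ha.trans hA
  exact mul_le_mul (mul_le_mul_of_nonneg_left hA hπ) hB hb (mul_nonneg hπ hA')

/-- **The upper Wendel bound**: for `k > 2`, `0 ≤ λ ≤ 2`,
`m̂_k(λ) ≤ π (k/2)/((k/2 − λ/2)(k/2 − (1 − λ/2)))`. -/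
theorem jacobi_le_wendel {k lam : ℝ} (hk : 2 < k) (h0 : 0 ≤ lam) (h2 : lam ≤ 2) :
    ∫ g, (1 - ‖orbit g‖ ^ 2) ^ (k / 2) * sph lam g ∂(nu haarCircle)
      ≤ π * (k / 2) / ((k / 2 - lam / 2) * (k / 2 - (1 - lam / 2))) := by
  have hx : (0 : ℝ) < k / 2 := by linarith
  have hxu : 0 < k / 2 - lam / 2 := by linarith
  have hxv : 0 < k / 2 - (1 - lam / 2) := by linarith
  rw [jacobi_eq_ratio_mul (by linarith) (by linarith) (by linarith)]
  have hA := Gamma_sub_div_le hxu (by linarith) (by linarith)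
  have hB := Gamma_sub_div_le hxv (by linarith) (by linarith)
  have hπ : (0 : ℝ) ≤ π := Real.pi_pos.le
  have hGA : 0 ≤ Real.Gamma (k / 2 - lam / 2) / Real.Gamma (k / 2) :=
    div_nonneg (Real.Gamma_pos_of_pos hxu).le (Real.Gamma_pos_of_pos hx).le
  have hGB : 0 ≤ Real.Gamma (k / 2 - (1 - lam / 2)) / Real.Gamma (k / 2) :=
    div_nonneg (Real.Gamma_pos_of_pos hxv).le (Real.Gamma_pos_of_pos hx).le
  have hb : 0 ≤ (k / 2) ^ (1 - lam / 2) / (k / 2 - lam / 2) :=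
    div_nonneg (Real.rpow_nonneg hx.le _) hxu.le
  calc π * (Real.Gamma (k / 2 - lam / 2) / Real.Gamma (k / 2))
        * (Real.Gamma (k / 2 - (1 - lam / 2)) / Real.Gamma (k / 2))
      ≤ π * ((k / 2) ^ (1 - lam / 2) / (k / 2 - lam / 2))
          * ((k / 2) ^ (1 - (1 - lam / 2)) / (k / 2 - (1 - lam / 2))) :=
        mul_le_mul (mul_le_mul_of_nonneg_left hA hπ) hB hGB (mul_nonneg hπ hb)
    _ = π * (k / 2) / ((k / 2 - lam / 2) * (k / 2 - (1 - lam / 2))) := by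
        rw [mul_assoc, div_mul_div_comm, ← Real.rpow_add hx,
          show 1 - lam / 2 + (1 - (1 - lam / 2)) = (1 : ℝ) by ring, Real.rpow_one, ← mul_div_assoc]

end measure

/-- At `λ = 0` both bounds are the exact value `2π/(k − 2)`. -/
theorem jacobi_wendel_zero_eq {k : ℝ} (hk : 2 < k) :
    π * (k / 2) / ((k / 2 - 0 / 2) * (k / 2 - (1 - 0 / 2))) = 2 * π / (k - 2) := by
  have h : k - 2 ≠ 0 := by
    intro h
    linarith
  have hD : k / 2 * (k / 2 - 1) ≠ 0 := by
    apply mul_ne_zero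
    · intro h0
      linarith
    · intro h0
      linarith
  simp only [zero_div, sub_zero]
  rw [div_eq_div_iff hD h]
  ring

/-! ### The Abel constants -/

/-- **`2π/(k − 1) ≤ C_k²`** for `k > 1`. -/
theorem abel_const_sq_ge {k : ℝ} (hk : 1 < k) :
    2 * π / (k - 1) ≤ (√π * Real.Gamma ((k - 1) / 2) / Real.Gamma (k / 2)) ^ 2 := by
  have hxu : 0 < k / 2 - 1 / 2 := by linarith
  have hA := Gamma_sub_div_ge hxu (by norm_num) (by norm_num)
  have hr : 0 ≤ (k / 2 - 1 / 2) ^ (-(1 / 2 : ℝ)) := Real.rpow_nonneg hxu.le _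
  have hsq : (k / 2 - 1 / 2) ^ (-(1 / 2 : ℝ)) * (k / 2 - 1 / 2) ^ (-(1 / 2 : ℝ)) = (k / 2 - 1 / 2)⁻¹ := by
    rw [← Real.rpow_add hxu, show -(1 / 2 : ℝ) + -(1 / 2) = -1 by norm_num, Real.rpow_neg_one]
  have e : (√π * Real.Gamma ((k - 1) / 2) / Real.Gamma (k / 2)) ^ 2
      = π * (Real.Gamma (k / 2 - 1 / 2) / Real.Gamma (k / 2)) ^ 2 := by
    rw [show (k - 1) / 2 = k / 2 - 1 / 2 by ring, mul_div_assoc, mul_pow, Real.sq_sqrt Real.pi_pos.le]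
  rw [e, show 2 * π / (k - 1) = π * (k / 2 - 1 / 2)⁻¹ by field_simp, ← hsq, ← sq]
  exact mul_le_mul_of_nonneg_left (pow_le_pow_left₀ hr hA 2) Real.pi_pos.le

/-- **`C_k² ≤ 2πk/(k − 1)²`** for `k > 1`. -/
theorem abel_const_sq_le {k : ℝ} (hk : 1 < k) :
    (√π * Real.Gamma ((k - 1) / 2) / Real.Gamma (k / 2)) ^ 2 ≤ 2 * π * k / (k - 1) ^ 2 := by
  have hx : (0 : ℝ) < k / 2 := by linarith
  have hxu : 0 < k / 2 - 1 / 2 := by linarith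
  have hB := Gamma_sub_div_le hxu (by norm_num) (by norm_num)
  have hG : 0 ≤ Real.Gamma (k / 2 - 1 / 2) / Real.Gamma (k / 2) :=
    div_nonneg (Real.Gamma_pos_of_pos hxu).le (Real.Gamma_pos_of_pos hx).le
  have e : (√π * Real.Gamma ((k - 1) / 2) / Real.Gamma (k / 2)) ^ 2
      = π * (Real.Gamma (k / 2 - 1 / 2) / Real.Gamma (k / 2)) ^ 2 := by
    rw [show (k - 1) / 2 = k / 2 - 1 / 2 by ring, mul_div_assoc, mul_pow, Real.sq_sqrt Real.pi_pos.le]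
  have hsq : ((k / 2) ^ (1 - 1 / 2 : ℝ) / (k / 2 - 1 / 2)) ^ 2 = (k / 2) / (k / 2 - 1 / 2) ^ 2 := by
    rw [div_pow, ← Real.rpow_natCast, ← Real.rpow_mul hx.le]
    norm_num
  rw [e, show 2 * π * k / (k - 1) ^ 2 = π * ((k / 2) / (k / 2 - 1 / 2) ^ 2) by field_simp, ← hsq]
  exact mul_le_mul_of_nonneg_left (pow_le_pow_left₀ hG hB 2) Real.pi_pos.le

section measure

variable [MeasurableSpace Circle] [BorelSpace Circle]

/-- **`C_k² ≤ 2π/(k − 2)`** for `k > 2`: `m̂_k(1) ≤ m̂_k(0)` since `Ξ ≤ 1 = φ_0`. -/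
theorem abel_const_sq_le_of_two_lt {k : ℝ} (hk : 2 < k) :
    (√π * Real.Gamma ((k - 1) / 2) / Real.Gamma (k / 2)) ^ 2 ≤ 2 * π / (k - 2) := by
  rw [← integral_orbit_rpow_mul_sph_one_eq_sq (by linarith), ← integral_orbit_rpow_mul_sph_zero hk]
  refine integral_mono (integrable_orbit_rpow_mul_sph (by linarith) (by linarith) (by linarith))
    (integrable_orbit_rpow_mul_sph (by linarith) (by linarith) (by linarith)) fun g => ?_
  refine mul_le_mul_of_nonneg_left ?_ (orbit_rpow_nonneg k g)
  rw [sph_zero]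
  exact sph_le_one (by norm_num) (by norm_num) g

end measure

/-- **`k · C_k² → 2π`** by the squeeze between the two explicit bounds (a second derivation of
`T5SU11JacobiWeightAsymptotic.tendsto_mul_abel_const_sq`). -/
theorem tendsto_mul_abel_const_sq' :
    Tendsto (fun k : ℝ => k * (√π * Real.Gamma ((k - 1) / 2) / Real.Gamma (k / 2)) ^ 2) atTop
      (𝓝 (2 * π)) := by
  have hlow : Tendsto (fun k : ℝ => 2 * π * (k / (k + -1)) ^ (1 : ℝ)) atTop (𝓝 (2 * π)) := by
    have := (tendsto_div_add_rpow (-1) 1).const_mul (2 * π)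
    rwa [mul_one] at this
  have hup : Tendsto (fun k : ℝ => 2 * π * (k / (k + -1)) ^ (2 : ℝ)) atTop (𝓝 (2 * π)) := by
    have := (tendsto_div_add_rpow (-1) 2).const_mul (2 * π)
    rwa [mul_one] at this
  refine tendsto_of_tendsto_of_tendsto_of_le_of_le' hlow hup ?_ ?_
  · filter_upwards [eventually_gt_atTop (1 : ℝ)] with k hk
    have h := abel_const_sq_ge hk
    have hk1 : k - 1 ≠ 0 := by
      intro h0
      linarith
    have hk1' : k + -1 ≠ 0 := by
      intro h0
      linarith
    have hk0 : 0 < k := by linarith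
    calc 2 * π * (k / (k + -1)) ^ (1 : ℝ) = k * (2 * π / (k - 1)) := by
          rw [Real.rpow_one]
          field_simp
          ring
      _ ≤ k * (√π * Real.Gamma ((k - 1) / 2) / Real.Gamma (k / 2)) ^ 2 :=
          mul_le_mul_of_nonneg_left h hk0.le
  · filter_upwards [eventually_gt_atTop (1 : ℝ)] with k hk
    have h := abel_const_sq_le hk
    have hk1 : k - 1 ≠ 0 := by
      intro h0
      linarith
    have hk1' : k + -1 ≠ 0 := by
      intro h0
      linarith
    have hk0 : 0 < k := by linarith
    calc k * (√π * Real.Gamma ((k - 1) / 2) / Real.Gamma (k / 2)) ^ 2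
        ≤ k * (2 * π * k / (k - 1) ^ 2) := mul_le_mul_of_nonneg_left h hk0.le
      _ = 2 * π * (k / (k + -1)) ^ (2 : ℝ) := by
          rw [Real.rpow_two]
          field_simp
          ring

end Summit.Ventures.HodgeRepro2.T5SU11JacobiWendelBounds
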